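import Mathlib
import Summits.Ventures.PercRepro2.BHKAvoid

/-!
# The conditional-BHK atoms of the single-vertex classes (blind cell PercRepro2, night-1 g9)

The four «b-side / o-side conditional-BHK atoms» of NIGHT1-G8.md §9″ —
`m1 = P_LN·B_H − P_LH·B_N ≥ 0`, `m2 = P_HN·B_L − P_HL·B_N ≥ 0`, `n1 = P_NL·A_H − P_HL·A_N ≥ 0`,
`n2 = P_NH·A_L − P_LH·A_N ≥ 0` (cells of the partition law of `(o, b)` under `Q = {a₁ ↮ a₂}`:
`P_xy = P(Q, o ∈ x, b ∈ y)`, `A_x = P(Q, o ∈ x)`, `B_y = P(Q, b ∈ y)`, `x, y ∈ {L, H, N}` =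
in `C(a₁)` / in `C(a₂)` / in neither) — are ONE inequality, BHK06 Thm 1.4 with the AVOIDED SET
`{a₂, y}` (the cell's `bhk_cross_cluster_avoid`, p1):

  `P(a₁ ↮ {a₂, y}, x ∈ C(a₁), y ∈ C(a₂)) · P(a₁ ↮ {a₂, y})
     ≤ P(a₁ ↮ {a₂, y}, x ∈ C(a₁)) · P(a₁ ↮ {a₂, y}, y ∈ C(a₂))`,

i.e. `Cov(1[x ∈ C(a₁)], 1[y ∈ C(a₂)]) ≤ 0` under `{a₁ ↮ a₂, a₁ ↮ y}`.  Under `Q`, `y ∈ C(a₂)`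
forces `a₁ ↮ y`, so the avoided event is `Q ∩ {y ∉ C(a₁)}` and splitting it by `y ∈ C(a₂)` gives
`P(Q, x ∈ C₁, y ∈ C₂) · P(Q, y ∈ N) ≤ P(Q, x ∈ C₁, y ∈ N) · P(Q, y ∈ C₂)` (`cross_avoid_pair`);
`(x, y) = (o, b)` is `m1`, the root swap is `m2`, `(x, y) = (b, o)` is `n1`, its root swap `n2`.

The two «refinements» `r1 = A_L·P_HH − A_H·P_LH ≥ 0`, `r2 = A_H·P_LL − A_L·P_HL ≥ 0`
(the complementary halves of the cross slack, `s_LH = n2 + r1`) are the chain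
`P(b ∈ C₂ | Q, o ∈ C₂) ≥ P(b ∈ C₂ | Q) ≥ P(b ∈ C₂ | Q, o ∈ C₁)` — same-cluster BHK
(`bhk_same_cluster_events`) times cross-cluster BHK (`bhk_cross_cluster`), with the zero cases
by monotonicity of `prob` (`refine_pair`).

These discharge the hypotheses `hm1`, `hm2` of `StarB.form_nonneg` (StarBCert.lean) — class B's
algebraic half is then unconditional — and settle the «m1 / m2: BHK instance or new lemma?»
question of ASSIGNMENTS v12.74 (p4 / engine (26)).
-/

namespace Summit.Ventures.PercRepro2

namespace StarB

section Atoms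

variable {V : Type*} {E : Type*} [Fintype E] [DecidableEq E] [Fintype V] [DecidableEq V]
  {R : Type*} [CommRing R] [LinearOrder R] [IsStrictOrderedRing R]

variable (p : E → R) (ends : E → Sym2 V)

omit [Fintype E] [DecidableEq E] [Fintype V] [DecidableEq V] [LinearOrder R]
  [IsStrictOrderedRing R] in
/-- `{C(s) ∋ v}` is the connection event. -/
lemma clusterInEvent_mem_eq' (s v : V) :
    clusterInEvent ends s {S : Set V | v ∈ S} = connEvent ends s v := by
  ext ω
  simp only [mem_clusterInEvent, Set.mem_setOf_eq, cluster, mem_connEvent]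

omit [Fintype E] [DecidableEq E] [Fintype V] [DecidableEq V] [LinearOrder R]
  [IsStrictOrderedRing R] in
/-- `Q = avoidAll ends a₂ {a₁}` as a complement. -/
lemma avoidAll_singleton_eq (a₁ a₂ : V) :
    avoidAll ends a₂ {a₁} = (connEvent ends a₁ a₂)ᶜ := by
  ext ω
  simp only [avoidAll, Set.mem_setOf_eq, Finset.mem_singleton, forall_eq, Set.mem_compl_iff,
    mem_connEvent]
  exact ⟨fun h h' => h (conn_symm h'), fun h h' => h (conn_symm h')⟩

omit [Fintype E] [DecidableEq E] [Fintype V] [LinearOrder R] [IsStrictOrderedRing R] in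
/-- `{a₁ ↮ a₂, a₁ ↮ y}` as a pair of complements. -/
lemma avoidAll_pair_eq (a₁ a₂ y : V) :
    avoidAll ends a₁ {a₂, y} = (connEvent ends a₁ a₂)ᶜ ∩ (connEvent ends a₁ y)ᶜ := by
  ext ω
  simp only [avoidAll, Set.mem_setOf_eq, Finset.mem_insert, Finset.mem_singleton,
    Set.mem_inter_iff, Set.mem_compl_iff, mem_connEvent]
  constructor
  · intro h
    exact ⟨h a₂ (Or.inl rfl), h y (Or.inr rfl)⟩
  · rintro ⟨h₁, h₂⟩ z hz
    rcases hz with rfl | rfl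
    · exact h₁
    · exact h₂

omit [Fintype E] [DecidableEq E] [Fintype V] [DecidableEq V] [LinearOrder R]
  [IsStrictOrderedRing R] in
/-- Under `{a₁ ↮ a₂}`, `y ∈ C(a₂)` forces `a₁ ↮ y`. -/
lemma inter_avoid_of_conn (a₁ a₂ y : V) (X : Set (Config E)) :
    X ∩ connEvent ends a₂ y ∩ ((connEvent ends a₁ a₂)ᶜ ∩ (connEvent ends a₁ y)ᶜ) =
      (connEvent ends a₁ a₂)ᶜ ∩ X ∩ connEvent ends a₂ y := by
  ext ω
  simp only [Set.mem_inter_iff, Set.mem_compl_iff, mem_connEvent]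
  constructor
  · rintro ⟨⟨hX, hy⟩, hQ, _⟩
    exact ⟨⟨hQ, hX⟩, hy⟩
  · rintro ⟨⟨hQ, hX⟩, hy⟩
    exact ⟨⟨hX, hy⟩, hQ, fun h => hQ (conn_trans h (conn_symm hy))⟩

/-- **The conditional-BHK atom** (BHK06 Thm 1.4 with the avoided set `{a₂, y}`): with
`Q = {a₁ ↮ a₂}` and `N_y = {y ∉ C(a₁), y ∉ C(a₂)}`,
`P(Q, x ∈ C(a₁), y ∈ C(a₂)) · P(Q, N_y) ≤ P(Q, x ∈ C(a₁), N_y) · P(Q, y ∈ C(a₂))`. -/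
theorem cross_avoid_pair (hp : IsProbVec p) (a₁ a₂ x y : V) :
    prob p ((connEvent ends a₁ a₂)ᶜ ∩ connEvent ends a₁ x ∩ connEvent ends a₂ y) *
        prob p ((connEvent ends a₁ a₂)ᶜ ∩ (connEvent ends a₁ y)ᶜ ∩ (connEvent ends a₂ y)ᶜ) ≤
      prob p ((connEvent ends a₁ a₂)ᶜ ∩ connEvent ends a₁ x ∩ (connEvent ends a₁ y)ᶜ ∩
          (connEvent ends a₂ y)ᶜ) *
        prob p ((connEvent ends a₁ a₂)ᶜ ∩ connEvent ends a₂ y) := by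
  classical
  have key := bhk_cross_cluster_avoid p hp ends a₁ a₂ (X := {a₂, y})
    (by simp) (𝓤 := {S : Set V | x ∈ S}) (𝓥 := {S : Set V | y ∈ S})
    (fun _ _ hST h => hST h) (fun _ _ hST h => hST h)
  rw [clusterInEvent_mem_eq', clusterInEvent_mem_eq', avoidAll_pair_eq] at key
  set A := (connEvent ends a₁ a₂)ᶜ ∩ (connEvent ends a₁ y)ᶜ with hA
  -- the four masses of `key`
  have e1 : connEvent ends a₁ x ∩ connEvent ends a₂ y ∩ A =
      (connEvent ends a₁ a₂)ᶜ ∩ connEvent ends a₁ x ∩ connEvent ends a₂ y :=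
    inter_avoid_of_conn ends a₁ a₂ y _
  have e2 : connEvent ends a₂ y ∩ A = (connEvent ends a₁ a₂)ᶜ ∩ connEvent ends a₂ y := by
    have h := inter_avoid_of_conn ends a₁ a₂ y Set.univ
    simpa only [Set.univ_inter, Set.inter_univ] using h
  have e3 : prob p (connEvent ends a₁ x ∩ A) =
      prob p ((connEvent ends a₁ a₂)ᶜ ∩ connEvent ends a₁ x ∩ connEvent ends a₂ y) +
        prob p ((connEvent ends a₁ a₂)ᶜ ∩ connEvent ends a₁ x ∩ (connEvent ends a₁ y)ᶜ ∩
          (connEvent ends a₂ y)ᶜ) := by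
    rw [← prob_inter_add_prob_inter_compl p (connEvent ends a₁ x ∩ A) (connEvent ends a₂ y)]
    congr 2
    · rw [Set.inter_right_comm, e1]
    · rw [hA]; ext ω; simp only [Set.mem_inter_iff, Set.mem_compl_iff]; tauto
  have e4 : prob p A =
      prob p ((connEvent ends a₁ a₂)ᶜ ∩ connEvent ends a₂ y) +
        prob p ((connEvent ends a₁ a₂)ᶜ ∩ (connEvent ends a₁ y)ᶜ ∩ (connEvent ends a₂ y)ᶜ) := by
    rw [← prob_inter_add_prob_inter_compl p A (connEvent ends a₂ y)]
    congr 2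
    · rw [Set.inter_comm, e2]
  rw [e1, e2, e3, e4] at key
  nlinarith [key]

/-- **`m1 ≥ 0`** in the `Q = avoidAll ends a₂ {a₁}` vocabulary of the StarO chain:
`P(Q, oL, bH) · P(Q, bN) ≤ P(Q, oL, bN) · P(Q, bH)`. -/
theorem m1_nonneg (hp : IsProbVec p) (o a₁ a₂ b : V) :
    0 ≤ prob p (avoidAll ends a₂ {a₁} ∩ connEvent ends a₁ o ∩ (connEvent ends a₁ b)ᶜ ∩
          (connEvent ends a₂ b)ᶜ) *
        prob p (avoidAll ends a₂ {a₁} ∩ connEvent ends a₂ b) -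
      prob p (avoidAll ends a₂ {a₁} ∩ connEvent ends a₁ o ∩ connEvent ends a₂ b) *
        prob p (avoidAll ends a₂ {a₁} ∩ (connEvent ends a₁ b)ᶜ ∩ (connEvent ends a₂ b)ᶜ) := by
  have h := cross_avoid_pair p ends hp a₁ a₂ o b
  have eQ : (connEvent ends a₁ a₂)ᶜ = avoidAll ends a₂ {a₁} :=
    (avoidAll_singleton_eq ends a₁ a₂).symm
  rw [eQ] at h
  linarith

/-- **`m2 ≥ 0`** (the root swap of `m1`): `P(Q, oH, bL) · P(Q, bN) ≤ P(Q, oH, bN) · P(Q, bL)`. -/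
theorem m2_nonneg (hp : IsProbVec p) (o a₁ a₂ b : V) :
    0 ≤ prob p (avoidAll ends a₂ {a₁} ∩ connEvent ends a₂ o ∩ (connEvent ends a₁ b)ᶜ ∩
          (connEvent ends a₂ b)ᶜ) *
        prob p (avoidAll ends a₂ {a₁} ∩ connEvent ends a₁ b) -
      prob p (avoidAll ends a₂ {a₁} ∩ connEvent ends a₂ o ∩ connEvent ends a₁ b) *
        prob p (avoidAll ends a₂ {a₁} ∩ (connEvent ends a₁ b)ᶜ ∩ (connEvent ends a₂ b)ᶜ) := by
  have h := cross_avoid_pair p ends hp a₂ a₁ o b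
  have eQ : (connEvent ends a₂ a₁)ᶜ = avoidAll ends a₂ {a₁} := by
    rw [avoidAll_singleton_eq, connEvent_comm]
  have eN : avoidAll ends a₂ {a₁} ∩ (connEvent ends a₂ b)ᶜ ∩ (connEvent ends a₁ b)ᶜ =
      avoidAll ends a₂ {a₁} ∩ (connEvent ends a₁ b)ᶜ ∩ (connEvent ends a₂ b)ᶜ := by
    rw [Set.inter_right_comm]
  have eN4 : avoidAll ends a₂ {a₁} ∩ connEvent ends a₂ o ∩ (connEvent ends a₂ b)ᶜ ∩
        (connEvent ends a₁ b)ᶜ =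
      avoidAll ends a₂ {a₁} ∩ connEvent ends a₂ o ∩ (connEvent ends a₁ b)ᶜ ∩
        (connEvent ends a₂ b)ᶜ := by
    rw [Set.inter_right_comm]
  rw [eQ, eN4, eN] at h
  linarith

/-- **`n1 ≥ 0`** (`o` and `b` exchanged): `P(Q, oH, bL) · P(Q, oN) ≤ P(Q, oN, bL) · P(Q, oH)`. -/
theorem n1_nonneg (hp : IsProbVec p) (o a₁ a₂ b : V) :
    0 ≤ prob p (avoidAll ends a₂ {a₁} ∩ connEvent ends a₁ b ∩ (connEvent ends a₁ o)ᶜ ∩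
          (connEvent ends a₂ o)ᶜ) *
        prob p (avoidAll ends a₂ {a₁} ∩ connEvent ends a₂ o) -
      prob p (avoidAll ends a₂ {a₁} ∩ connEvent ends a₁ b ∩ connEvent ends a₂ o) *
        prob p (avoidAll ends a₂ {a₁} ∩ (connEvent ends a₁ o)ᶜ ∩ (connEvent ends a₂ o)ᶜ) :=
  m1_nonneg p ends hp b a₁ a₂ o

/-- **`n2 ≥ 0`**: `P(Q, oL, bH) · P(Q, oN) ≤ P(Q, oN, bH) · P(Q, oL)`. -/
theorem n2_nonneg (hp : IsProbVec p) (o a₁ a₂ b : V) :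
    0 ≤ prob p (avoidAll ends a₂ {a₁} ∩ connEvent ends a₂ b ∩ (connEvent ends a₁ o)ᶜ ∩
          (connEvent ends a₂ o)ᶜ) *
        prob p (avoidAll ends a₂ {a₁} ∩ connEvent ends a₁ o) -
      prob p (avoidAll ends a₂ {a₁} ∩ connEvent ends a₂ b ∩ connEvent ends a₁ o) *
        prob p (avoidAll ends a₂ {a₁} ∩ (connEvent ends a₁ o)ᶜ ∩ (connEvent ends a₂ o)ᶜ) :=
  m2_nonneg p ends hp b a₁ a₂ o

/-- The two BHK inputs of the refinements, in the `Q = avoidAll ends a₂ {a₁}` vocabulary: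
same-cluster `P(Q, oH) · P(Q, bH) ≤ P(Q, oH, bH) · P(Q)` and cross-cluster
`P(Q, oL, bH) · P(Q) ≤ P(Q, oL) · P(Q, bH)`. -/
lemma same_and_cross (hp : IsProbVec p) (o a₁ a₂ b : V) :
    prob p (avoidAll ends a₂ {a₁} ∩ connEvent ends a₂ o) *
        prob p (avoidAll ends a₂ {a₁} ∩ connEvent ends a₂ b) ≤
      prob p (avoidAll ends a₂ {a₁} ∩ connEvent ends a₂ o ∩ connEvent ends a₂ b) *
        prob p (avoidAll ends a₂ {a₁}) ∧
    prob p (avoidAll ends a₂ {a₁} ∩ connEvent ends a₁ o ∩ connEvent ends a₂ b) *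
        prob p (avoidAll ends a₂ {a₁}) ≤
      prob p (avoidAll ends a₂ {a₁} ∩ connEvent ends a₁ o) *
        prob p (avoidAll ends a₂ {a₁} ∩ connEvent ends a₂ b) := by
  have eQ : (connEvent ends a₂ a₁)ᶜ = avoidAll ends a₂ {a₁} := by
    rw [avoidAll_singleton_eq, connEvent_comm]
  have eQ' : (connEvent ends a₁ a₂)ᶜ = avoidAll ends a₂ {a₁} :=
    (avoidAll_singleton_eq ends a₁ a₂).symm
  have eXQ : ∀ X : Set (Config E), X ∩ avoidAll ends a₂ {a₁} = avoidAll ends a₂ {a₁} ∩ X :=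
    fun X => Set.inter_comm _ _
  have eXYQ : ∀ X Y : Set (Config E), X ∩ Y ∩ avoidAll ends a₂ {a₁} =
      avoidAll ends a₂ {a₁} ∩ X ∩ Y := by
    intro X Y; ext ω; simp only [Set.mem_inter_iff]; tauto
  constructor
  · have h := bhk_same_cluster_events p hp ends a₂ a₁ (𝓤 := {S : Set V | o ∈ S})
      (𝓥 := {S : Set V | b ∈ S}) (fun _ _ hST h => hST h) (fun _ _ hST h => hST h)
    rw [clusterInEvent_mem_eq', clusterInEvent_mem_eq', eQ, eXYQ, eXQ, eXQ] at h
    exact h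
  · have h := bhk_cross_cluster p hp ends a₁ a₂ (𝓤 := {S : Set V | o ∈ S})
      (𝓥 := {S : Set V | b ∈ S}) (fun _ _ hST h => hST h) (fun _ _ hST h => hST h)
    rw [clusterInEvent_mem_eq', clusterInEvent_mem_eq', eQ', eXYQ, eXQ, eXQ] at h
    exact h

/-- **`r1 ≥ 0`**: `P(Q, oH) · P(Q, oL, bH) ≤ P(Q, oL) · P(Q, oH, bH)` — the chain
`P(bH | Q, oL) ≤ P(bH | Q) ≤ P(bH | Q, oH)` (cross-cluster, then same-cluster BHK), with the
degenerate cases `P(Q) = 0` / `P(Q, bH) = 0` by monotonicity. -/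
theorem r1_nonneg (hp : IsProbVec p) (o a₁ a₂ b : V) :
    0 ≤ prob p (avoidAll ends a₂ {a₁} ∩ connEvent ends a₁ o) *
          prob p (avoidAll ends a₂ {a₁} ∩ connEvent ends a₂ o ∩ connEvent ends a₂ b) -
        prob p (avoidAll ends a₂ {a₁} ∩ connEvent ends a₂ o) *
          prob p (avoidAll ends a₂ {a₁} ∩ connEvent ends a₁ o ∩ connEvent ends a₂ b) := by
  obtain ⟨hsame, hcross⟩ := same_and_cross p ends hp o a₁ a₂ b
  set Z := prob p (avoidAll ends a₂ {a₁}) with hZ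
  set AL := prob p (avoidAll ends a₂ {a₁} ∩ connEvent ends a₁ o) with hAL
  set AH := prob p (avoidAll ends a₂ {a₁} ∩ connEvent ends a₂ o) with hAH
  set BH := prob p (avoidAll ends a₂ {a₁} ∩ connEvent ends a₂ b) with hBH
  set PHH := prob p (avoidAll ends a₂ {a₁} ∩ connEvent ends a₂ o ∩ connEvent ends a₂ b) with hPHH
  set PLH := prob p (avoidAll ends a₂ {a₁} ∩ connEvent ends a₁ o ∩ connEvent ends a₂ b) with hPLH
  have hZ0 : 0 ≤ Z := prob_nonneg hp _
  have hBH0 : 0 ≤ BH := prob_nonneg hp _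
  have hAL0 : 0 ≤ AL := prob_nonneg hp _
  have hAH0 : 0 ≤ AH := prob_nonneg hp _
  have hPHH0 : 0 ≤ PHH := prob_nonneg hp _
  have hPLH0 : 0 ≤ PLH := prob_nonneg hp _
  have hALZ : AL ≤ Z := prob_mono hp Set.inter_subset_left
  have hAHZ : AH ≤ Z := prob_mono hp Set.inter_subset_left
  have hPHHB : PHH ≤ BH := prob_mono hp (by
    intro ω hω; exact ⟨hω.1.1, hω.2⟩)
  have hPLHB : PLH ≤ BH := prob_mono hp (by
    intro ω hω; exact ⟨hω.1.1, hω.2⟩)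
  rcases eq_or_lt_of_le (mul_nonneg hZ0 hBH0) with h0 | hpos
  · rcases mul_eq_zero.1 h0.symm with hZz | hBz
    · have e1 : AL = 0 := le_antisymm (hZz ▸ hALZ) hAL0
      have e2 : AH = 0 := le_antisymm (hZz ▸ hAHZ) hAH0
      rw [e1, e2]; ring_nf; exact le_refl _
    · have e1 : PHH = 0 := le_antisymm (hBz ▸ hPHHB) hPHH0
      have e2 : PLH = 0 := le_antisymm (hBz ▸ hPLHB) hPLH0
      rw [e1, e2]; ring_nf; exact le_refl _
  · have hprod := mul_le_mul hsame hcross (mul_nonneg hPLH0 hZ0) (mul_nonneg hPHH0 hZ0)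
    have h' : (Z * BH) * (AH * PLH) ≤ (Z * BH) * (AL * PHH) := by
      have e1 : (Z * BH) * (AH * PLH) = AH * BH * (PLH * Z) := by ring
      have e2 : (Z * BH) * (AL * PHH) = PHH * Z * (AL * BH) := by ring
      rw [e1, e2]; exact hprod
    have := le_of_mul_le_mul_left h' hpos
    linarith

/-- **`r2 ≥ 0`** (the root swap of `r1`): `P(Q, oL) · P(Q, oH, bL) ≤ P(Q, oH) · P(Q, oL, bL)`. -/
theorem r2_nonneg (hp : IsProbVec p) (o a₁ a₂ b : V) :
    0 ≤ prob p (avoidAll ends a₂ {a₁} ∩ connEvent ends a₂ o) *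
          prob p (avoidAll ends a₂ {a₁} ∩ connEvent ends a₁ o ∩ connEvent ends a₁ b) -
        prob p (avoidAll ends a₂ {a₁} ∩ connEvent ends a₁ o) *
          prob p (avoidAll ends a₂ {a₁} ∩ connEvent ends a₂ o ∩ connEvent ends a₁ b) := by
  have h := r1_nonneg p ends hp o a₂ a₁ b
  have eQ : avoidAll ends a₁ {a₂} = avoidAll ends a₂ {a₁} := by
    rw [avoidAll_singleton_eq, avoidAll_singleton_eq, connEvent_comm]
  rw [eQ] at h
  exact h

end Atoms

end StarB

end Summit.Ventures.PercRepro2
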